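import Mathlib
import Literature.Analysis.FluidPDE.VectorCalculus
import Literature.Analysis.FluidPDE.RadialCalculus

set_option linter.dupNamespace false

/-!
# A smooth solenoidal test field in the unit ball with prescribed value at the origin

Stub `landauTail_exists_divFree_test` (S7) for the crux `stmt-NavierStokesRegularity-1944`
(`Summit.NavierStokesRegularity.NavierStokesRegularity.Theses.LandauTail.LandauTailBlowup`):
for every `a ∈ ℝ³` there is a `C^∞`, compactly supported, divergence-free vector field
`φ : ℝ³ → ℝ³` with `tsupport φ ⊆ ball 0 1` and `φ 0 = a`.

The witness is the curl of the vector potential `½ η(‖y‖²) (a × y)`, written out as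
`φ(y) = (η(ρ) + ρ η'(ρ)) • a − (η'(ρ) ⟪a, y⟫) • y`, `ρ = ‖y‖²`, for a smooth cut-off
`η : ℝ → ℝ` with `η(0) = 1` and `η = 0` on `(1/4, ∞)` (here `η(t) = smoothTransition (1 − 4t)`).
Its divergence is computed as the trace of the Fréchet derivative and vanishes identically.
[folklore]
-/

open scoped RealInnerProductSpace
open InnerProductSpace Literature.Analysis.FluidPDE

namespace Summit.NavierStokesRegularity.NavierStokesRegularity.Theorems

/-- The trace of the rank-one map `y ↦ ℓ(y) v` is `ℓ(v)` (Mathlib `LinearMap.trace_smulRight`,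
transported along the coercion from continuous linear maps). [folklore] -/
theorem landauTail_trace_smulRight (ℓ : EuclideanSpace ℝ (Fin 3) →L[ℝ] ℝ)
    (v : EuclideanSpace ℝ (Fin 3)) :
    LinearMap.trace ℝ (EuclideanSpace ℝ (Fin 3))
      ((ℓ.smulRight v : EuclideanSpace ℝ (Fin 3) →L[ℝ] EuclideanSpace ℝ (Fin 3)) :
        EuclideanSpace ℝ (Fin 3) →ₗ[ℝ] EuclideanSpace ℝ (Fin 3)) = ℓ v :=
  LinearMap.trace_smulRight _ _

/-- **Solenoidality of the test field.** For a smooth profile `η`, the field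
`y ↦ (η(‖y‖²) + ‖y‖² η'(‖y‖²)) • a − (η'(‖y‖²) ⟪a, y⟫) • y` (the curl of `½ η(‖y‖²) (a × y)`)
has vanishing divergence at every point: `div (f • a) = Df(a) = 2(2η' + ρη'')⟪y, a⟫` cancels
`div (g • y) = Dg(y) + 3g = (2ρη'' + 4η')⟪a, y⟫`. [folklore] -/
theorem landauTail_divFree_test_divergence {η : ℝ → ℝ} (hη : ContDiff ℝ (⊤ : ℕ∞) η)
    (a x : EuclideanSpace ℝ (Fin 3)) :
    VectorCalculus.divergence (fun y : EuclideanSpace ℝ (Fin 3) =>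
      (η (‖y‖ ^ 2) + ‖y‖ ^ 2 * deriv η (‖y‖ ^ 2)) • a - (deriv η (‖y‖ ^ 2) * ⟪a, y⟫) • y) x
      = 0 := by
  obtain ⟨hd1, hη'⟩ := contDiff_infty_iff_deriv.mp hη
  have hd2 : Differentiable ℝ (deriv η) := (contDiff_infty_iff_deriv.mp hη').1
  have h1 : HasDerivAt η (deriv η (‖x‖ ^ 2)) (‖x‖ ^ 2) := (hd1 _).hasDerivAt
  have h2 : HasDerivAt (deriv η) (deriv (deriv η) (‖x‖ ^ 2)) (‖x‖ ^ 2) := (hd2 _).hasDerivAt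
  have hF : HasDerivAt (fun t => η t + t * deriv η t)
      (deriv η (‖x‖ ^ 2) + (1 * deriv η (‖x‖ ^ 2) + ‖x‖ ^ 2 * deriv (deriv η) (‖x‖ ^ 2)))
      (‖x‖ ^ 2) := h1.add ((hasDerivAt_id _).mul h2)
  have hA := (hasFDerivAt_comp_norm_sq (z := x) hF).smul_const a
  have hB : HasFDerivAt (fun w : EuclideanSpace ℝ (Fin 3) => ⟪a, w⟫)
      (innerSL ℝ a : EuclideanSpace ℝ (Fin 3) →L[ℝ] ℝ) x :=
    (innerSL ℝ a : EuclideanSpace ℝ (Fin 3) →L[ℝ] ℝ).hasFDerivAt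
  have hC := ((hasFDerivAt_comp_norm_sq (z := x) h2).mul hB).smul (hasFDerivAt_id x)
  have hφ : HasFDerivAt (fun y : EuclideanSpace ℝ (Fin 3) =>
      (η (‖y‖ ^ 2) + ‖y‖ ^ 2 * deriv η (‖y‖ ^ 2)) • a - (deriv η (‖y‖ ^ 2) * ⟪a, y⟫) • y) _ x :=
    hA.sub hC
  rw [VectorCalculus.divergence, hφ.fderiv]
  simp only [ContinuousLinearMap.toLinearMap_sub, ContinuousLinearMap.toLinearMap_add,
    ContinuousLinearMap.toLinearMap_smul, map_sub, map_add, map_smul,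
    landauTail_trace_smulRight, ContinuousLinearMap.coe_id, LinearMap.trace_id,
    finrank_euclideanSpace_fin]
  simp only [smul_apply, add_apply, coe_innerSL_apply, Pi.mul_apply, id_eq, smul_eq_mul,
    real_inner_self_eq_norm_sq, real_inner_comm a x]
  ring

/-- **Smoothness of the test field**: built from `η ∘ ‖·‖²`, `η' ∘ ‖·‖²`, the inner product and
scalar multiplication, all `C^∞`. [folklore] -/
theorem landauTail_divFree_test_contDiff {η : ℝ → ℝ} (hη : ContDiff ℝ (⊤ : ℕ∞) η)
    (a : EuclideanSpace ℝ (Fin 3)) :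
    ContDiff ℝ (⊤ : ℕ∞) (fun y : EuclideanSpace ℝ (Fin 3) =>
      (η (‖y‖ ^ 2) + ‖y‖ ^ 2 * deriv η (‖y‖ ^ 2)) • a - (deriv η (‖y‖ ^ 2) * ⟪a, y⟫) • y) := by
  have hη' : ContDiff ℝ (⊤ : ℕ∞) (deriv η) := (contDiff_infty_iff_deriv.mp hη).2
  have hn : ContDiff ℝ (⊤ : ℕ∞) (fun y : EuclideanSpace ℝ (Fin 3) => ‖y‖ ^ 2) :=
    contDiff_norm_sq ℝ
  exact (((hη.comp hn).add (hn.mul (hη'.comp hn))).smul contDiff_const).sub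
    (((hη'.comp hn).mul (contDiff_const.inner ℝ contDiff_id)).smul contDiff_id)

/-- **Support of the test field**: if the profile `η` vanishes on `(1/4, ∞)` then the field
vanishes at every `y` with `‖y‖ > 1/2` (there `η(‖y‖²) = η'(‖y‖²) = 0`, the latter because `η`
is locally constant). [folklore] -/
theorem landauTail_divFree_test_eq_zero {η : ℝ → ℝ} (hη0 : ∀ t : ℝ, 1 / 4 < t → η t = 0)
    (a : EuclideanSpace ℝ (Fin 3)) {y : EuclideanSpace ℝ (Fin 3)} (hy : 1 / 2 < ‖y‖) :
    (η (‖y‖ ^ 2) + ‖y‖ ^ 2 * deriv η (‖y‖ ^ 2)) • a - (deriv η (‖y‖ ^ 2) * ⟪a, y⟫) • y = 0 := by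
  have hρ : 1 / 4 < ‖y‖ ^ 2 := by nlinarith
  have h2 : deriv η (‖y‖ ^ 2) = 0 := by
    have he : η =ᶠ[nhds (‖y‖ ^ 2)] fun _ => (0 : ℝ) := by
      filter_upwards [Ioi_mem_nhds hρ] with t ht using hη0 t ht
    rw [he.deriv_eq, deriv_const]
  simp [hη0 _ hρ, h2]

/-- **A smooth solenoidal test field supported in the unit ball with prescribed value at the
origin.** For every `a ∈ ℝ³` there is `φ ∈ C_c^∞(ℝ³; ℝ³)` with `tsupport φ ⊆ B(0, 1)`,
`div φ ≡ 0` and `φ(0) = a`; witness `φ(y) = (η(ρ) + ρη'(ρ)) a − η'(ρ)⟪a, y⟫ y`, `ρ = ‖y‖²`,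
`η(t) = smoothTransition (1 − 4t)` (the curl of `½ η(‖y‖²) a × y`). [folklore] -/
theorem landauTail_exists_divFree_test : ∀ a : EuclideanSpace ℝ (Fin 3), ∃ φ : EuclideanSpace ℝ (Fin 3) → EuclideanSpace ℝ (Fin 3), ContDiff ℝ (⊤ : ℕ∞) φ ∧ HasCompactSupport φ ∧ tsupport φ ⊆ Metric.ball (0 : EuclideanSpace ℝ (Fin 3)) 1 ∧ (∀ x, Literature.Analysis.FluidPDE.VectorCalculus.divergence φ x = 0) ∧ φ 0 = a := by
  intro a
  obtain ⟨η, hη, hη1, hη0⟩ : ∃ η : ℝ → ℝ, ContDiff ℝ (⊤ : ℕ∞) η ∧ η 0 = 1 ∧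
      ∀ t : ℝ, 1 / 4 < t → η t = 0 := by
    refine ⟨fun t => Real.smoothTransition (1 - 4 * t),
      Real.smoothTransition.contDiff.comp (contDiff_const.sub (contDiff_const.mul contDiff_id)),
      by simp [Real.smoothTransition.one], fun t ht => ?_⟩
    exact Real.smoothTransition.zero_of_nonpos (by linarith)
  have hsupp : Function.support (fun y : EuclideanSpace ℝ (Fin 3) =>
      (η (‖y‖ ^ 2) + ‖y‖ ^ 2 * deriv η (‖y‖ ^ 2)) • a - (deriv η (‖y‖ ^ 2) * ⟪a, y⟫) • y)
      ⊆ Metric.closedBall (0 : EuclideanSpace ℝ (Fin 3)) (1 / 2) := by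
    intro y hy
    rw [Metric.mem_closedBall, dist_zero_right]
    by_contra h
    exact hy (landauTail_divFree_test_eq_zero hη0 a (not_le.mp h))
  refine ⟨fun y => (η (‖y‖ ^ 2) + ‖y‖ ^ 2 * deriv η (‖y‖ ^ 2)) • a
      - (deriv η (‖y‖ ^ 2) * ⟪a, y⟫) • y, landauTail_divFree_test_contDiff hη a,
    HasCompactSupport.of_support_subset_isCompact (isCompact_closedBall _ _) hsupp,
    (closure_minimal hsupp Metric.isClosed_closedBall).trans
      (Metric.closedBall_subset_ball (by norm_num)),
    fun x => landauTail_divFree_test_divergence hη a x, ?_⟩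
  simp [hη1]

end Summit.NavierStokesRegularity.NavierStokesRegularity.Theorems
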